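import Summits.ABC.IUTFork.LDHTensor
import Summits.ABC.IUTFork.LDHHullSupport
import Literature.IUT.LogVolume.TensorPacketUnramifiedShell
import Literature.IUT.LogVolume.TensorPacketSlotUnion
import HarnessLib

/-!
# The fork at [IUTchIII] Corollary 3.12, L-DH level: [IUTchIV] Thm. 1.10 Step (vi) for Dupuy–Hilado data over
# the REAL tensor-packet model — the three summand-level facts of `LDHHullSupport` DISCHARGED at odd
# unramified primes, and the Step (vi) input `hoff` of the local proof data

Record-only file (D-0012) of the abc-iut cell (WAVE-3 discharge seat abc-iut-c312-d1; plan/D9PRIME-OBLIGATIONS.md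
row O3, identification half); TAKES NO SIDE. Mochizuki, *IUT IV* (RIMS ms Apr. 2020), proof of Thm. 1.10, Step (vi),
p. 29: "the inclusion "`φ((R_I)^∼) ⊆ (R_I)^∼`" … the tensor product of log-shells … contains the "union of possible
images of a Θ-pilot object" … Such an upper bound “`0`”". abc-iut-S2's `LDHHullSupport` proves `log μ̄(hull(U_Θ)_{v⃗})
= 0` at a prime from three facts: `hshell` (`I_{v⃗} = O_{v⃗}`), `hhull` (`hull(O_{v⃗}) = O_{v⃗}`), `hbare`
(`(O_𝕃(−P_Θ))^{Ind3}_{v⃗} ⊆ O_{v⃗}`). For `D = DHData.ofTensor X 𝔽 d T …` (abc-iut-c312-3, over `tensorPacketModel 𝔽`)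
this file DISCHARGES them at every prime `p > 2` over which all the fields `K_{v̲}` are UNRAMIFIED, in the degrees
`j ≥ 1`: `hshell` is abc-iut-S1's `inv_two_p_pow_smul_logPacket_eq_normalizedPacket` (`(2p)^{−|I|}·log_p(R_I^×) =
(R_I)^∼`), `hhull` is abc-iut-S2's `packetHull_normalizedPacket`, and `hbare` follows from the SHARP reading of
(Ind3) at `v⃗` (the datum equals the bare region) because the theta scalar at a place outside `S` is a UNIT
(`ord_v = P_{Θ,j}(v) = 0`, so it does not move `(R_I)^∼`, `TensorPacketSlotUnion.iota_smul_normalizedPacket_eq_of_norm_eq_one`).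
Result `DHData.hoff_ofTensor_of_sharp`: off a set `dst ⊇ char(S) ∪ {2} ∪ {ramified}` every component of
`hull(U_Θ)` in the degrees `1 ≤ j ≤ ℓ⋇` has `log μ̄ = 0` (so `≤ 0`: the hypothesis `hoff` of
`localProofDataAvgOfDH`). [cite: Mochizuki2012, IUTchIV Thm 1.10 proof Step (vi) p.29]
[cite: DupuyHilado2025, §4.7, §4.9–4.12] [claim: Mochizuki2012, status: disputed]
HONEST SCOPE: hypotheses named (unramified odd prime, sharp datum at the tuple); nothing about Cor. 3.12.
-/

noncomputable section

open Set NumberField IsDedekindDomain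
open scoped Pointwise

namespace Literature.IUT.LogVolume

variable {F : Type} [Field F] [NumberField F] {p : ℕ} [Fact p.Prime] (𝔽 : LocalFields F p)

/-- `hshell` for the real packet: at `p > 2` with every `K_{v̲_a}/ℚ_p` unramified and `|I| = j+1 ≥ 2`, the
log-shell `(2p)^{−|I|}·log_p(R_I^×)` IS `(R_I)^∼`. [cite: Mochizuki2012, IUTchIV Prop. 1.4 (iv) p. 13] -/
theorem realPrimePacket_shell_eq_O (hp : 2 < p) {j : ℕ} (hj : 1 ≤ j) (e : Fin (j + 1) → placesOver F p)
    (he : ∀ a, absRamificationIdx p (𝔽.k (e a)) = 1) :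
    (realPrimePacket p 𝔽).shell j e = (realPrimePacket p 𝔽).O j e := by
  rw [realPrimePacket_shell, realPrimePacket_O]
  have hI : 2 ≤ Fintype.card (Fin (j + 1)) := by rw [Fintype.card_fin]; omega
  exact inv_two_p_pow_smul_logPacket_eq_normalizedPacket p (fun a => 𝔽.k (e a)) hI hp he

/-- `hhull` for the real packet: `hull((R_I)^∼) = (R_I)^∼`. [cite: DupuyHilado2025, §4.12] -/
theorem realPrimePacket_hullLoc_O {j : ℕ} (e : Fin (j + 1) → placesOver F p) :
    (realPrimePacket p 𝔽).hullLoc j e ((realPrimePacket p 𝔽).O j e) = (realPrimePacket p 𝔽).O j e := by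
  rw [realPrimePacket_hullLoc, realPrimePacket_O]
  exact packetHull_normalizedPacket p (fun a => 𝔽.k (e a))

/-- A unit theta scalar does not move the bare region: `ord_v(t) = 0 ⇒ t·O_{v⃗} = O_{v⃗}` in the real packet.
[cite: DupuyHilado2025, §3.4, §3.9] -/
theorem realPrimePacket_peel_O_of_ordv_eq_zero {j : ℕ} (e : Fin (j + 1) → placesOver F p)
    (t : (𝔽.k (e (Fin.last j)))ˣ) (ht : 𝔽.ordv t = 0) :
    (realPrimePacket p 𝔽).peel t '' (realPrimePacket p 𝔽).O j e = (realPrimePacket p 𝔽).O j e := by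
  rw [realPrimePacket_peel_image, realPrimePacket_O]
  have hlog : Real.log ‖(t : 𝔽.k (e (Fin.last j)))‖ = 0 := by
    rw [𝔽.log_norm_eq_neg_ordv t, ht]; simp
  have hnorm : ‖(t : 𝔽.k (e (Fin.last j)))‖ = 1 := by
    rcases Real.log_eq_zero.mp hlog with h | h | h
    · exact absurd h (norm_ne_zero_iff.mpr t.ne_zero)
    · exact h
    · exact absurd h (by have := norm_nonneg (t : 𝔽.k (e (Fin.last j))); linarith)
  exact iota_smul_normalizedPacket_eq_of_norm_eq_one p (fun a => 𝔽.k (e a)) (Fin.last j) hnorm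

end Literature.IUT.LogVolume

namespace Summit.ABC.IUTFork

open Literature.IUT.LogVolume NumberField IsDedekindDomain
open scoped Pointwise

variable {F : Type} [Field F] [NumberField F]

namespace DHData

/-- **Step (vi) input `hoff` for Dupuy–Hilado data over the REAL model.** For `D = ofTensor X 𝔽 d T …` and a set
`dst` of primes containing `char(S)`: if every prime `p ∈ T ∖ dst` is odd with all `K_{v̲}` (`v | p`) unramified,
and the (Ind3)-datum is SHARP at the tuples over such `p` (`(O_𝕃(−P_Θ))^{Ind3}_{v⃗} ⊆ O_𝕃(−P_Θ)_{v⃗}`), then every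
component of `hull(U_Θ)` over `T ∖ dst` in the degrees `1 ≤ j ≤ ℓ⋇` has `log μ̄ = 0`, in particular `≤ 0`.
[cite: Mochizuki2012, IUTchIV Thm 1.10 proof Step (vi) p.29] [claim: Mochizuki2012, status: disputed] -/
theorem hoff_ofTensor_of_sharp (X : PilotData F) (𝔽 : LocalFieldFamily F)
    (d : ∀ (p : ℕ) (hp : p.Prime), (@realPrimePacket F _ _ p ⟨hp⟩ (𝔽 p hp)).DHDatum X)
    (T : Finset ℕ) (T_prime : ∀ p ∈ T, p.Prime) (S_sub : ∀ v ∈ X.S, residueChar F v ∈ T)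
    (dst : Finset ℕ) (hST : ∀ v ∈ X.S, residueChar F v ∈ dst)
    (hodd : ∀ p ∈ T, p ∉ dst → 2 < p)
    (hunram : ∀ (p : ℕ) [hp : Fact p.Prime], p ∈ T → p ∉ dst → ∀ v : placesOver F p,
      absRamificationIdx p ((𝔽 p hp.out).k v) = 1)
    (hsharp : ∀ p ∈ T, p ∉ dst → ∀ (j : ℕ) (e : Fin (j + 1) → placesOver F p),
      (ofTensor X 𝔽 d T T_prime S_sub).ind3.bare3 p j e ⊆
        (ofTensor X 𝔽 d T T_prime S_sub).M.region (ofTensor X 𝔽 d T T_prime S_sub).tΘ p j e) :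
    ∀ p ∈ (ofTensor X 𝔽 d T T_prime S_sub).T, p ∉ dst → ∀ j, 1 ≤ j →
      j ≤ (ofTensor X 𝔽 d T T_prime S_sub).X.lstar → ∀ e : Fin (j + 1) → placesOver F p,
        (ofTensor X 𝔽 d T T_prime S_sub).M.logμ
          ((ofTensor X 𝔽 d T T_prime S_sub).M.hullUTheta (ofTensor X 𝔽 d T T_prime S_sub).ind3 p j e) ≤ 0 := by
  set D := ofTensor X 𝔽 d T T_prime S_sub with hD
  intro p hpT hpd j hj1 hj2 e
  haveI hp : Fact p.Prime := ⟨T_prime p hpT⟩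
  have hQ : D.M.primePart p = realPrimePacket p (𝔽 p hp.out) := primePart_tensorPacketModel 𝔽 hp.out
  -- the three facts at (p, j), transported from the real packet along `hQ`
  have key : ∀ (Q : PrimePacket F p), Q = realPrimePacket p (𝔽 p hp.out) →
      (∀ e' : Fin (j + 1) → placesOver F p, Q.shell j e' = Q.O j e') ∧
      (∀ e' : Fin (j + 1) → placesOver F p, Q.hullLoc j e' (Q.O j e') = Q.O j e') ∧
      (∀ (e' : Fin (j + 1) → placesOver F p) (t : Q.Λ (e' (Fin.last j))), Q.ordv t = 0 →
        Q.peel t '' Q.O j e' = Q.O j e') := by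
    rintro Q rfl
    exact ⟨fun e' => realPrimePacket_shell_eq_O (𝔽 p hp.out) (hodd p hpT hpd) hj1 e'
        (fun a => hunram p hpT hpd (e' a)),
      fun e' => realPrimePacket_hullLoc_O (𝔽 p hp.out) e',
      fun e' t ht => realPrimePacket_peel_O_of_ordv_eq_zero (𝔽 p hp.out) e' t ht⟩
  obtain ⟨hshell, hhull, hpeel⟩ := key (D.M.primePart p) hQ
  refine (D.logμ_hullUTheta_eq_zero_of_shell hST hp.out hpd (fun e' => hshell e') (fun e' => hhull e')
    (fun e' => ?_) e).le
  -- `hbare` at `e'`: sharp datum ⊆ bare region = unit twist of `O` = `O` (the last place is outside `S`)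
  refine (hsharp p hpT hpd j e').trans ?_
  have hv : (e' (Fin.last j)).1 ∉ X.S := by
    intro hv
    have h := hST _ hv
    rw [(mem_placesOver_iff_residueChar (e' (Fin.last j)).1).mp (e' (Fin.last j)).2] at h
    exact hpd h
  show PacketModel.region D.M.toPacketModel D.tΘ p j e' ⊆ D.M.O p j e'
  unfold PacketModel.region
  split_ifs with h
  · have h0 : D.M.ordv (D.tΘ ⟨j - 1, h.2⟩ p (e' (Fin.last j))) = 0 := by
      rw [D.tΘ_ord]
      exact D.thetaPilot_apply_of_not_mem hv _
    exact (hpeel e' _ h0).subset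
  · exact subset_rfl

end DHData

end Summit.ABC.IUTFork

end
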